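import Summits.HodgeConjecture.HodgeConjecture.Theorems.VHCAbelianSchemesRoadSecantQuotientResidualSpecialFibre
import Literature.AlgebraicGeometry.HodgeTheory.AbelianThreefoldsStablyNondegenerate
import Literature.AlgebraicGeometry.HodgeTheory.FiniteProductsMixedPowersRetract
import HarnessLib

/-!
# Road b02 (`VHCAbelianSchemesRoad`, D-0059) — THE PINNED `(6,3)` RESIDUAL (stub 2b″ of skeleton v3.1 of crux `SemiregularSheafRepresentativesTwAtDiag`,
# stmt-HodgeConjecture-19787): THE SECOND HONEST SPECIAL FIBRE — LEFSCHETZ FIBRES (`Bᵖ = Dᵖ`), SUPPLIED UNCONDITIONALLY BY POWERS OF ABELIAN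
# VARIETIES OF DIMENSION `≤ 3`; HEADLINE: ABELIAN-SURFACE POWERS (the QM-cubes `S_δ³` of the NON-SPLIT Weil components)

research route conditional on HC_CM; not a corollary; Q11.4-sentence-2 already refuted in dim ≥ 3.

FACT-FREE; `HC_CM` nowhere; no `def`; sequel to `VHCAbelianSchemesRoadSecantQuotientResidualSpecialFibre` (p525692: the converse of (O2), special-fibre
carriers shrink any conditional cell, the FIRST honest special fibre = elliptic powers). The stub `stub_residual_63_secantQuotientPinned` (T3
PLAN-ONLY designate) is NOT restated, claimed or weakened: every theorem IMPLIES it (or a conditional cell containing it) from named statements, or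
compares two of its sub-cells (ring2-b03 gen 82 on director-hodge g8's LANES MAP №4, HOME INBOX l.5061, under LEAD 155; choice: the next fibre).

THE ANCHOR. A **LEFSCHETZ FIBRE** is a fibre `𝒳_t ≅ A₀.X` with `A₀` an abelian `n`-fold whose Hodge ring is generated by divisor classes,
`IsDivisorGenerated A₀` («`B•(A₀) = D•(A₀) ⊗ ℂ`», van Geemen §2.4): there EVERY rational `(p,p)` class is a polynomial in divisor classes,
hence algebraic (Lefschetz `(1,1)` and products — tree theorems), unconditionally. Anchor data (lambda, no definition):
«`∃ A₀, dim A₀ = n ∧ IsDivisorGenerated A₀ ∧ A₀.X ≅ X`, `θ` a polarisation class» ∕ «algebraic classes» (`= Dᵖ ⊗ ℂ` there, §3).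

THE SUPPLY (tree theorems, UNCONDITIONAL; §1): `IsDivisorGenerated A₀` — indeed `IsStablyNondegenerate A₀` (Gordon Thm. 7.5 ∕ Def. 7.6 =
Moonen–Zarhin's condition (D): `B = D` on ALL powers) — holds for every `A₀` ISOGENOUS TO A POWER `B₀^{N+1}` OF AN ABELIAN VARIETY OF DIMENSION
`1`, `2` OR `3` (`isStablyNondegenerate_of_dim_pos_of_dim_le_three`: Tate–Murasaki for curves; Moonen–Zarhin (2.2) — types I(1), I(2), II(1),
IV(2,1) — and `E′ × E″` for surfaces; Moonen–Zarhin Thm. 0.1 (4) ∕ (5.2) for threefolds; `IsStablyNondegenerate.powSucc`, `.of_isIsogenous`). So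
the elliptic-power anchors of the prequel are the `dim B₀ = 1` case, and the NEW positive-dimensional supply on the sixfold Weil components is
the case `dim B₀ = 2`: **ABELIAN-SURFACE CUBES `X ≅ A₀ ~ S₀³`.**

WHY ABELIAN-SURFACE CUBES (arithmetic AS PRINTED, untyped — family supply is not in the tree): on a `(3, d, δ)` Weil-type component for
`K = ℚ(√−D)` the hermitian form has rank `6`, signature `(3,3)`, discriminant `δ < 0`, so by Landherr's classification
`H ≅ ⟨1,δ⟩ ⊥ ⟨1,δ⟩ ⊥ ⟨1,δ⟩`, and the component contains the diagonal locus of sixfolds isogenous to `S³`, `S` running over the abelian SURFACES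
with a `K`-action of signature `(1,1)` and form `⟨1,δ⟩` = the surfaces with multiplication by the indefinite quaternion algebra
`B_δ = (−D, −δ)_ℚ ∋ K`, a DIVISION algebra exactly when `−δ ∉ N(K^×)` (non-split; generic `S` simple of type II(1)), `≅ M₂(ℚ)` exactly when split
(`S ~ E²`: André's tensor points `E ⊗ 𝒪_K`). A compact Shimura CURVE's worth of Lefschetz fibres on every non-split component, whose `K`-CM points
are the `E_K³ × Ē_K³` points of the prequel: the non-splitness is absorbed by the quaternion algebra of the surface factor, and the Weil class
restricts there to a Lefschetz class (Morita: `H¹(S³; ℂ) = St ⊗ W`, `dim W = 6`, `NS(S³) ⊗ ℂ = Sym² W^∨`, `B³(S³) ⊗ ℂ = S_{(2,2,2)}(W^∨)` of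
dimension `175`, the Weil line `det(W_σ^∨)² ⊕ det(W_σ̄^∨)²`; the Weil entry of `q³/3!` for `L ↔ q` is `det q_{σσ}` — evidence memo of this generation).

§1 per variety: at `X ≅ A₀.X`, `A₀` divisor-generated of dimension `n`, every rational `(p,p)` class lies in `Dᵖ(X) ⊗ ℂ` and is algebraic;
the supply and the anchor implications elliptic-power ⟹ low-dimensional-power ⟹ Lefschetz, abelian-surface-power ⟹ Lefschetz. §2 served fibres:
affine base (the cell's shape), compact twin, and — door ∧ Lefschetz-fibre carriers — algebraicity on EVERY fibre of every compact abelian pencil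
through a Lefschetz fibre. §3 cell level: carriers ⟹ the cell on pencils with a Lefschetz fibre; anchor antitonicity (the new carrier statement
contains the prequel's elliptic-power one and the abelian-surface-power one); at Lefschetz anchors «carriers for the rational ALGEBRAIC classes»
⟺ «carriers for the rational classes of `Dᵖ ⊗ ℂ`» (the find-the-sheaf problem is about POLYNOMIALS IN DIVISOR CLASSES modulo `θᵖ`);
**`secantQuotientResidual63Pinned_of_lefschetzCarrierAt_of_under_not_not`: (b″) ⟸ `AnchoredCarrierAt (tw C AdmTw) 6 3 𝔄_Lef 𝔄lg` ∧ the cell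
on the pencils with NO pinned-served fibre AND NO Lefschetz fibre** — a residual cell IMPLIED BY the prequel's doubly residual
(`under_notLefschetz_of_under_notEllipticPower`: fewer pencils) — and the rung form. §4 door level at `I = {p}`: a `{p−1}`-semiregular vector
bundle with a rational algebraic `B`-field and `(e^{B₀} ch F)_p = a·w + c·θᵖ` for every rational `w ∈ Dᵖ(X) ⊗ ℂ` on every polarised
divisor-generated abelian `n`-fold gives the Lefschetz-fibre carrier statement (honest reading as in the prequel: side degrees return through
Pridham Cor. 2.25).

What is NOT claimed: (b″), (a″), the rung, the crux, any carrier statement, any cell, K-SR♭∃, VHC, `HC_AV`, HC; that Lefschetz-fibre carriers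
exist; that any pencil of the residual HAS a Lefschetz fibre (the Landherr ∕ Shimura-curve supply above is untyped: the sub-partition is
bookkeeping, non-vacuous in nature); NECESSITY of Lefschetz-fibre carriers (the constant pencil is void there: regime 1).
References: [cite: vanGeemen1994HodgeAV, §2.4, Thm. 4.3, Thm. 4.11, 5.2–5.5] [cite: MoonenZarhin1999LowDim, Thm. 0.1 (4), §2 (2.2), condition (D),
(5.2)] [cite: Gordon1999HodgeAVSurvey, Thm. 7.5, Def. 7.6] [cite: Bloch1972Semiregularity, Remark (7.5)] [cite: BuchweitzFlenner2003, Def. 4.1, §5 Thm. 5.1]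
[cite: Pridham2024Semiregularity, Cor. 2.25 and Rem. 2.26] [cite: Markman2025SecantWeil, §1.1, Thm. 1.4.1 and Thm. 1.5.1] [cite: MumfordAV1970, §19–§21]
[cite: Andre1996Motifs, Lemme 6.3.3 (ii) (p. 33)] [cite: VoisinHodgeI2002, Thm. 6.25, Thm. 7.10, Thm. 11.30 and §7.1.2] [cite: CharlesSchnell2014Notes, Prop. 11.3.11].
-/

noncomputable section

open CategoryTheory CategoryTheory.Limits AlgebraicGeometry Topology

-- the cell's namespace repeats the summit name (`Summit.HodgeConjecture.HodgeConjecture…`), as in every `Ring2*` file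
set_option linter.dupNamespace false
namespace Summit.HodgeConjecture.HodgeConjecture.Ring2.SemiregularRepresentatives

open Literature.AlgebraicGeometry Literature.AlgebraicGeometry.Motives
open Literature.AlgebraicGeometry.HodgeTheory
open Literature.AlgebraicTopology.SingularHomology
open Literature.Barriers.HodgeConjecture (divisorClassesSpan)
open Literature.AlgebraicGeometry.Andre1996 (compactPencil_dim_eq_of_iso)
open Summit.Ventures.HSemireg (ObjClass LocalVariationalHodgeFor)
open Summit.HodgeConjecture.HodgeConjecture.Ring2.Binders (exists_forall_isPolarizationClass_map_fiberι)

variable {𝒪 : ObjClass} {n p : ℕ}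
variable {𝒳 S : SchemeOver ℂ} {f : 𝒳 ⟶ S}

/-! ## §1 Per variety: at a Lefschetz anchor every rational `(p,p)` class is a Lefschetz class, hence algebraic; the unconditional supply -/

/-- **AT A LEFSCHETZ ANCHOR EVERY RATIONAL `(p,p)` CLASS IS A LEFSCHETZ CLASS**: on `X ≅ A₀.X` with `A₀` an abelian `n`-fold whose Hodge ring is
generated by divisor classes (`IsDivisorGenerated A₀`, «`B = D`»), every rational class of type `(p,p)` lies in `Dᵖ(X) ⊗ ℂ` (`B = D` on `A₀`,
moved along the isomorphism: `D ⊗ ℂ` is functorial under pull-back). [cite: vanGeemen1994HodgeAV, §2.4 and §3.6] [cite: MoonenZarhin1999LowDim, §2 condition (D)] -/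
theorem mem_divisorClassesSpan_of_lefschetzAnchor {X : SchemeOver ℂ} {A₀ : AbelianVariety ℂ} (hd : A₀.dim = n) (hD : IsDivisorGenerated A₀)
    (e₀ : A₀.X ≅ X) {w : complexBetti X (2 * p)} (hwQ : IsRationalClass w) (hw : IsOfHodgeType n X (2 * p) p p w) :
    w ∈ divisorClassesSpan X n p := by
  subst hd
  have hXA : IsSmoothProjective A₀.dim A₀.X := AbelianVariety.isSmoothProjective_holds (A := A₀)
  have hX : IsSmoothProjective A₀.dim X := hXA.of_iso e₀
  have h1 : complexBetti.map e₀.hom (2 * p) w ∈ divisorClassesSpan A₀.X A₀.dim p :=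
    hD p (complexBetti.map e₀.hom (2 * p) w) ((isRationalClass_map_iff_of_iso e₀).2 hwQ) ((isOfHodgeType_map_iff_of_iso e₀).2 hw)
  have h2 := map_mem_divisorClassesSpan hX hXA e₀.inv h1
  rwa [e₀.complexBetti_map_inv_map_hom] at h2

/-- **… HENCE ALGEBRAIC** (Lefschetz `(1,1)` and «`cl(Z·D) = cl Z ∪ cl D`» on the smooth projective `X`: the tree's
`divisorClassesSpan_le_algebraicClasses_of_isSmoothProjective`). Unconditional; this is what the served-class map «algebraic classes» consumes.
[cite: vanGeemen1994HodgeAV, §2.4] [cite: VoisinHodgeI2002, Thm. 11.30] -/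
theorem mem_algebraicClasses_of_lefschetzAnchor {X : SchemeOver ℂ} {A₀ : AbelianVariety ℂ} (hd : A₀.dim = n) (hD : IsDivisorGenerated A₀)
    (e₀ : A₀.X ≅ X) {w : complexBetti X (2 * p)} (hwQ : IsRationalClass w) (hw : IsOfHodgeType n X (2 * p) p p w) :
    w ∈ algebraicClasses X p := by
  have hX : IsSmoothProjective n X := by
    subst hd
    exact (AbelianVariety.isSmoothProjective_holds (A := A₀)).of_iso e₀
  exact divisorClassesSpan_le_algebraicClasses_of_isSmoothProjective hX p (mem_divisorClassesSpan_of_lefschetzAnchor hd hD e₀ hwQ hw)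

/-- **THE UNCONDITIONAL SUPPLY: an abelian variety isogenous to a power of an abelian variety of dimension `1`, `2` or `3` is STABLY
NON-DEGENERATE** (`B = D` on it and on all its powers): Tate–Murasaki (curves), Moonen–Zarhin (2.2) and `E′ × E″` (surfaces), Moonen–Zarhin
Thm. 0.1 (4) ∕ (5.2) (threefolds) — the tree's `isStablyNondegenerate_of_dim_pos_of_dim_le_three` — then powers and isogeny invariance. The case
`dim B₀ = 2`, `N = 2`, `n = 6` is the QM-cube locus `S_δ³` of the non-split `(3,d,δ)` components (module docstring).
[cite: MoonenZarhin1999LowDim, Thm. 0.1 (4), §2 (2.2) and (5.2)] [cite: Gordon1999HodgeAVSurvey, Thm. 7.5 and Def. 7.6] [cite: vanGeemen1994HodgeAV, Thm. 4.3 and §3.6] -/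
theorem isStablyNondegenerate_of_isIsogenous_powSucc_of_dim_le_three {A₀ B₀ : AbelianVariety ℂ} {N : ℕ} (h0 : 0 < B₀.dim)
    (h3 : B₀.dim ≤ 3) (hiso : A₀.IsIsogenous (B₀.powSucc N)) : IsStablyNondegenerate A₀ :=
  ((isStablyNondegenerate_of_dim_pos_of_dim_le_three h0 h3).powSucc N).of_isIsogenous hiso

/-- **In particular every abelian variety isogenous to a power `S₀^{N+1}` of an abelian SURFACE is stably non-degenerate** (simple: types
I(1), I(2), II(1), IV(2,1), the tree's `AbelianVariety.isStablyNondegenerate_of_isSimple_surface`; non-simple: `S₀ ~ E′ × E″`) — the QM-cubes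
`S_δ³` included. [cite: MoonenZarhin1999LowDim, §2 (2.2) and Thm. 0.1 (4)] [cite: Gordon1999HodgeAVSurvey, Thm. 7.5 and Def. 7.6] -/
theorem isStablyNondegenerate_of_isIsogenous_powSucc_surface {A₀ S₀ : AbelianVariety ℂ} {N : ℕ} (hS₀ : S₀.dim = 2)
    (hiso : A₀.IsIsogenous (S₀.powSucc N)) : IsStablyNondegenerate A₀ :=
  isStablyNondegenerate_of_isIsogenous_powSucc_of_dim_le_three (by omega) (by omega) hiso

/-- **Anchor implication: a LOW-DIMENSIONAL-POWER fibre is a Lefschetz fibre** («`X ≅ A₀ ~ B₀^{N+1}`, `0 < dim B₀ ≤ 3`» ⟹ «`X ≅ A₀`,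
`B = D` on `A₀`»). [cite: MoonenZarhin1999LowDim, Thm. 0.1 (4) and §2 condition (D)] -/
theorem lefschetzAnchor_of_lowDimPowerAnchor {X : SchemeOver ℂ}
    (h : ∃ (A₀ B₀ : AbelianVariety ℂ) (N : ℕ), A₀.dim = n ∧ 0 < B₀.dim ∧ B₀.dim ≤ 3 ∧ A₀.IsIsogenous (B₀.powSucc N) ∧ Nonempty (A₀.X ≅ X)) :
    ∃ A₀ : AbelianVariety ℂ, A₀.dim = n ∧ IsDivisorGenerated A₀ ∧ Nonempty (A₀.X ≅ X) := by
  obtain ⟨A₀, B₀, N, hd, h0, h3, hiso, he⟩ := h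
  exact ⟨A₀, hd, (isStablyNondegenerate_of_isIsogenous_powSucc_of_dim_le_three h0 h3 hiso).isDivisorGenerated, he⟩

/-- **Anchor implication: an ELLIPTIC-POWER fibre (the prequel's anchor) is a Lefschetz fibre** (`dim B₀ = 1`). [cite: vanGeemen1994HodgeAV, Thm. 4.3] -/
theorem lefschetzAnchor_of_ellipticPowerAnchor {X : SchemeOver ℂ}
    (h : ∃ (A₀ E₀ : AbelianVariety ℂ) (N : ℕ), A₀.dim = n ∧ E₀.dim = 1 ∧ A₀.IsIsogenous (E₀.powSucc N) ∧ Nonempty (A₀.X ≅ X)) :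
    ∃ A₀ : AbelianVariety ℂ, A₀.dim = n ∧ IsDivisorGenerated A₀ ∧ Nonempty (A₀.X ≅ X) := by
  obtain ⟨A₀, E₀, N, hd, hE₀, hiso, he⟩ := h
  exact lefschetzAnchor_of_lowDimPowerAnchor ⟨A₀, E₀, N, hd, by omega, by omega, hiso, he⟩

/-- **Anchor implication: an ABELIAN-SURFACE-POWER fibre is a Lefschetz fibre** (`dim B₀ = 2`). [cite: MoonenZarhin1999LowDim, §2 (2.2)] -/
theorem lefschetzAnchor_of_abelianSurfacePowerAnchor {X : SchemeOver ℂ}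
    (h : ∃ (A₀ S₀ : AbelianVariety ℂ) (N : ℕ), A₀.dim = n ∧ S₀.dim = 2 ∧ A₀.IsIsogenous (S₀.powSucc N) ∧ Nonempty (A₀.X ≅ X)) :
    ∃ A₀ : AbelianVariety ℂ, A₀.dim = n ∧ IsDivisorGenerated A₀ ∧ Nonempty (A₀.X ≅ X) := by
  obtain ⟨A₀, S₀, N, hd, hS₀, hiso, he⟩ := h
  exact lefschetzAnchor_of_lowDimPowerAnchor ⟨A₀, S₀, N, hd, by omega, by omega, hiso, he⟩

/-! ## §2 Lefschetz fibres are served fibres (affine base; compact pencils); algebraicity everywhere on compact pencils through them -/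

/-- **A PENCIL WITH A LEFSCHETZ FIBRE IS SERVED THERE** (affine base, quasi-projective total space — the cell's shape) for the anchor data
«`X ≅ A₀`, `A₀` an abelian `n`-fold with `B = D`, `θ` a polarisation class» ∕ «algebraic classes»: polarise by the relative hyperplane class
(the prequel's `hasServedFibre_algebraic_of_fibre`); `W|_t` is algebraic by §1. [cite: vanGeemen1994HodgeAV, §2.4]
[cite: VoisinHodgeI2002, Thm. 6.25, Thm. 7.10 and Thm. 11.30] [cite: Bloch1972Semiregularity, Remark (7.5)] -/
theorem hasServedFibre_of_lefschetzFibre (hf : IsSmoothProjectiveFamily f n) (h𝒳 : IsQuasiProjectiveOver 𝒳) [IsAffine S.left]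
    {t : ComplexPoints S} {A₀ : AbelianVariety ℂ} (hd : A₀.dim = n) (hD : IsDivisorGenerated A₀) (e₀ : A₀.X ≅ fiberOver f t)
    (W : complexBetti 𝒳 (2 * p))
    (hW : ∀ s : ComplexPoints S, IsRationalClass (complexBetti.map (fiberι f s) (2 * p) W) ∧
      IsOfHodgeType n (fiberOver f s) (2 * p) p p (complexBetti.map (fiberι f s) (2 * p) W)) :
    HasServedFibre n p
      (fun X θ ↦ (∃ A₀ : AbelianVariety ℂ, A₀.dim = n ∧ IsDivisorGenerated A₀ ∧ Nonempty (A₀.X ≅ X)) ∧ IsPolarizationClass n X θ)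
      (fun X _ ↦ (algebraicClasses X p : Set (complexBetti X (2 * p)))) f W :=
  hasServedFibre_algebraic_of_fibre hf h𝒳 (fun _ hθ ↦ ⟨⟨A₀, hd, hD, ⟨e₀⟩⟩, hθ⟩)
    (fun _ hwQ hw ↦ mem_algebraicClasses_of_lefschetzAnchor hd hD e₀ hwQ hw) W hW

/-- **Instance: a pencil with a fibre isogenous to a power of an abelian SURFACE is served there** (the pencils through an `S_δ³`-point of a
non-split Weil component; `B = D` by `isStablyNondegenerate_of_isIsogenous_powSucc_surface`). [cite: MoonenZarhin1999LowDim, §2 (2.2)]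
[cite: vanGeemen1994HodgeAV, §2.4 and 5.4] [cite: Bloch1972Semiregularity, Remark (7.5)] -/
theorem hasServedFibre_of_abelianSurfacePowerFibre (hf : IsSmoothProjectiveFamily f n) (h𝒳 : IsQuasiProjectiveOver 𝒳) [IsAffine S.left]
    {t : ComplexPoints S} {A₀ S₀ : AbelianVariety ℂ} {N : ℕ} (hd : A₀.dim = n) (hS₀ : S₀.dim = 2) (hiso : A₀.IsIsogenous (S₀.powSucc N))
    (e₀ : A₀.X ≅ fiberOver f t) (W : complexBetti 𝒳 (2 * p))
    (hW : ∀ s : ComplexPoints S, IsRationalClass (complexBetti.map (fiberι f s) (2 * p) W) ∧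
      IsOfHodgeType n (fiberOver f s) (2 * p) p p (complexBetti.map (fiberι f s) (2 * p) W)) :
    HasServedFibre n p
      (fun X θ ↦ (∃ A₀ : AbelianVariety ℂ, A₀.dim = n ∧ IsDivisorGenerated A₀ ∧ Nonempty (A₀.X ≅ X)) ∧ IsPolarizationClass n X θ)
      (fun X _ ↦ (algebraicClasses X p : Set (complexBetti X (2 * p)))) f W :=
  hasServedFibre_of_lefschetzFibre hf h𝒳 hd (isStablyNondegenerate_of_isIsogenous_powSucc_surface hS₀ hiso).isDivisorGenerated e₀ W hW

/-- **The COMPACT twin: a compact pencil of abelian varieties with a Lefschetz fibre is served there** (same anchor data; the shape of the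
André column's pencils — PART `EllipticPowerAnchors` §1 is the elliptic case). [cite: Andre1996Motifs, Lemme 6.3.3 (ii) (p. 33)]
[cite: vanGeemen1994HodgeAV, §2.4] [cite: VoisinHodgeI2002, Thm. 6.25 and Thm. 7.10] -/
theorem hasServedFibre_compactPencil_of_lefschetzFibre (hf : IsCompactAbelianPencil f n) {s₀ : ComplexPoints S} {A₀ : AbelianVariety ℂ}
    (hD : IsDivisorGenerated A₀) (e₀ : A₀.X ≅ fiberOver f s₀) (W : complexBetti 𝒳 (2 * p))
    (hW : ∀ s : ComplexPoints S, IsRationalClass (complexBetti.map (fiberι f s) (2 * p) W) ∧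
      IsOfHodgeType n (fiberOver f s) (2 * p) p p (complexBetti.map (fiberι f s) (2 * p) W)) :
    HasServedFibre n p
      (fun X θ ↦ (∃ A₀ : AbelianVariety ℂ, A₀.dim = n ∧ IsDivisorGenerated A₀ ∧ Nonempty (A₀.X ≅ X)) ∧ IsPolarizationClass n X θ)
      (fun X _ ↦ (algebraicClasses X p : Set (complexBetti X (2 * p)))) f W := by
  haveI : IsSeparated S.hom :=
    (IsQuasiProjectiveOver.of_isProjectiveOver hf.isSmoothProjective_base.isProjectiveOver).isSeparated
  obtain ⟨Θ, hΘ⟩ := exists_forall_isPolarizationClass_map_fiberι f hf.isSmoothProjectiveFamily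
    (IsQuasiProjectiveOver.of_isProjectiveOver hf.isSmoothProjective_total.isProjectiveOver)
  have hd : A₀.dim = n := compactPencil_dim_eq_of_iso hf e₀
  exact ⟨s₀, Θ, fun s ↦ (hΘ s).isRationalClass,
    fun s ↦ isOfHodgeType_of_mem_algebraicClasses_of_isSmoothProjective (hf.isSmoothProjectiveFamily.isSmoothProjective s) 1
      (hΘ s).mem_algebraicClasses,
    ⟨⟨A₀, hd, hD, ⟨e₀⟩⟩, hΘ s₀⟩, mem_algebraicClasses_of_lefschetzAnchor hd hD e₀ (hW s₀).1 (hW s₀).2⟩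

/-- **DOOR ∧ LEFSCHETZ-FIBRE CARRIERS ⟹ on every compact pencil of abelian `n`-folds through a Lefschetz fibre (e.g. through an `S_δ³`-point),
every fibrewise rational `(p,p)` class is algebraic on EVERY fibre** (PART AA-f: the algebraicity locus is closed and uncountable). This is what
a carrier on a QM-cube would buy on a non-split Weil component, granted compact pencils through it. [cite: BuchweitzFlenner2003, §5 Thm. 5.1]
[cite: Bloch1972Semiregularity, Remark (7.5)] [cite: CharlesSchnell2014Notes, Prop. 11.3.11 (proof)] [cite: vanGeemen1994HodgeAV, 5.4–5.5] -/
theorem mem_algebraicClasses_compactPencil_of_lefschetzFibre_of_anchoredCarrierAt (hT : LocalVariationalHodgeFor 𝒪)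
    (hcar : AnchoredCarrierAt 𝒪 n p
      (fun X θ ↦ (∃ A₀ : AbelianVariety ℂ, A₀.dim = n ∧ IsDivisorGenerated A₀ ∧ Nonempty (A₀.X ≅ X)) ∧ IsPolarizationClass n X θ)
      (fun X _ ↦ (algebraicClasses X p : Set (complexBetti X (2 * p)))))
    (hf : IsCompactAbelianPencil f n) {s₀ : ComplexPoints S} {A₀ : AbelianVariety ℂ} (hD : IsDivisorGenerated A₀) (e₀ : A₀.X ≅ fiberOver f s₀)
    (W : complexBetti 𝒳 (2 * p))
    (hW : ∀ s : ComplexPoints S, IsRationalClass (complexBetti.map (fiberι f s) (2 * p) W) ∧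
      IsOfHodgeType n (fiberOver f s) (2 * p) p p (complexBetti.map (fiberι f s) (2 * p) W))
    (s : ComplexPoints S) : complexBetti.map (fiberι f s) (2 * p) W ∈ algebraicClasses (fiberOver f s) p :=
  mem_algebraicClasses_compactPencil_of_anchoredCarrierAt_of_hasServedFibre hT hcar hf W hW
    (hasServedFibre_compactPencil_of_lefschetzFibre hf hD e₀ W hW) s

/-! ## §3 Cell level: Lefschetz-fibre carriers settle the pencils through a Lefschetz fibre; served = Lefschetz there; (b″) ⟸ carriers ∧ the residual -/

/-- **LEFSCHETZ-FIBRE CARRIERS GIVE EVERY CELL ON THE PENCILS WITH A LEFSCHETZ FIBRE** (door-, degree-generic): `AnchoredCarrierAt 𝒪 n p` at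
«Lefschetz anchors» ∕ «algebraic classes» ⟹ the cell `(n, p)` under «some fibre is isomorphic to a divisor-generated abelian `n`-fold».
[cite: Bloch1972Semiregularity, Remark (7.5)] [cite: vanGeemen1994HodgeAV, §2.4 and Thm. 4.11] -/
theorem under_lefschetzFibre_of_lefschetzCarrierAt
    (hA : AnchoredCarrierAt 𝒪 n p
      (fun X θ ↦ (∃ A₀ : AbelianVariety ℂ, A₀.dim = n ∧ IsDivisorGenerated A₀ ∧ Nonempty (A₀.X ≅ X)) ∧ IsPolarizationClass n X θ)
      (fun X _ ↦ (algebraicClasses X p : Set (complexBetti X (2 * p))))) :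
    LefAtExceptionalRegimeAtUnder 𝒪 n p (fun _ S f _ ↦ ∃ (t : ComplexPoints S) (A₀ : AbelianVariety ℂ),
      A₀.dim = n ∧ IsDivisorGenerated A₀ ∧ Nonempty (A₀.X ≅ fiberOver f t)) := by
  intro 𝒳 S f hf h𝒳 hirr haff hsm hdim hab hsec W hW s₀ halg hexc hP
  obtain ⟨t, A₀, hd, hD, ⟨e₀⟩⟩ := hP
  haveI := haff
  exact exists_lefAtDatum_of_anchoredCarrierAt hA hf W hW (hasServedFibre_of_lefschetzFibre hf h𝒳 hd hD e₀ W hW)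

/-- **The Lefschetz-fibre carrier statement CONTAINS the prequel's elliptic-power carrier statement** (the anchored carrier statement is antitone
in the anchor predicate; elliptic powers are Lefschetz fibres). [cite: vanGeemen1994HodgeAV, Thm. 4.3] [cite: Bloch1972Semiregularity, Remark (7.5)] -/
theorem ellipticPowerCarrierAt_of_lefschetzCarrierAt
    (hA : AnchoredCarrierAt 𝒪 n p
      (fun X θ ↦ (∃ A₀ : AbelianVariety ℂ, A₀.dim = n ∧ IsDivisorGenerated A₀ ∧ Nonempty (A₀.X ≅ X)) ∧ IsPolarizationClass n X θ)
      (fun X _ ↦ (algebraicClasses X p : Set (complexBetti X (2 * p))))) :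
    AnchoredCarrierAt 𝒪 n p
      (fun X θ ↦ (∃ (A₀ E₀ : AbelianVariety ℂ) (N : ℕ), A₀.dim = n ∧ E₀.dim = 1 ∧ A₀.IsIsogenous (E₀.powSucc N) ∧
        Nonempty (A₀.X ≅ X)) ∧ IsPolarizationClass n X θ)
      (fun X _ ↦ (algebraicClasses X p : Set (complexBetti X (2 * p)))) :=
  anchoredCarrierAt_anti (fun _ _ h ↦ ⟨lefschetzAnchor_of_ellipticPowerAnchor h.1, h.2⟩) (fun _ _ _ ↦ subset_rfl) hA

/-- **… and the abelian-surface-power carrier statement** (the `S_δ³`-points: the per-variety find-the-sheaf problem on polarised sixfolds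
isogenous to the cube of a QM abelian surface is an instance of the Lefschetz-fibre one). [cite: MoonenZarhin1999LowDim, §2 (2.2)]
[cite: Bloch1972Semiregularity, Remark (7.5)] -/
theorem abelianSurfacePowerCarrierAt_of_lefschetzCarrierAt
    (hA : AnchoredCarrierAt 𝒪 n p
      (fun X θ ↦ (∃ A₀ : AbelianVariety ℂ, A₀.dim = n ∧ IsDivisorGenerated A₀ ∧ Nonempty (A₀.X ≅ X)) ∧ IsPolarizationClass n X θ)
      (fun X _ ↦ (algebraicClasses X p : Set (complexBetti X (2 * p))))) :
    AnchoredCarrierAt 𝒪 n p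
      (fun X θ ↦ (∃ (A₀ S₀ : AbelianVariety ℂ) (N : ℕ), A₀.dim = n ∧ S₀.dim = 2 ∧ A₀.IsIsogenous (S₀.powSucc N) ∧
        Nonempty (A₀.X ≅ X)) ∧ IsPolarizationClass n X θ)
      (fun X _ ↦ (algebraicClasses X p : Set (complexBetti X (2 * p)))) :=
  anchoredCarrierAt_anti (fun _ _ h ↦ ⟨lefschetzAnchor_of_abelianSurfacePowerAnchor h.1, h.2⟩) (fun _ _ _ ↦ subset_rfl) hA

/-- **AT LEFSCHETZ ANCHORS THE SERVED CLASSES ARE THE LEFSCHETZ CLASSES: «carriers for the rational ALGEBRAIC classes» ⟺ «carriers for the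
rational classes of `Dᵖ(X) ⊗ ℂ`»** (⟹: `Dᵖ ⊗ ℂ ⊆ Nᵖ` on the smooth projective `X`; ⟸: an algebraic class is of type `(p,p)`, hence in `Dᵖ ⊗ ℂ`
by `B = D`). So the Lefschetz-fibre carrier statement is a find-the-sheaf problem for prescribed POLYNOMIALS IN DIVISOR CLASSES modulo `θᵖ` on
polarised divisor-generated abelian `n`-folds — for the Weil residual: the Lefschetz limit of the Weil class at an `S_δ³`-point.
[cite: vanGeemen1994HodgeAV, §2.4] [cite: VoisinHodgeI2002, Thm. 11.30 and Prop. 11.20] [cite: Bloch1972Semiregularity, Remark (7.5)] -/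
theorem anchoredCarrierAt_lefschetz_iff_divisorial :
    AnchoredCarrierAt 𝒪 n p
        (fun X θ ↦ (∃ A₀ : AbelianVariety ℂ, A₀.dim = n ∧ IsDivisorGenerated A₀ ∧ Nonempty (A₀.X ≅ X)) ∧ IsPolarizationClass n X θ)
        (fun X _ ↦ (algebraicClasses X p : Set (complexBetti X (2 * p)))) ↔
      AnchoredCarrierAt 𝒪 n p
        (fun X θ ↦ (∃ A₀ : AbelianVariety ℂ, A₀.dim = n ∧ IsDivisorGenerated A₀ ∧ Nonempty (A₀.X ≅ X)) ∧ IsPolarizationClass n X θ)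
        (fun X _ ↦ (divisorClassesSpan X n p : Set (complexBetti X (2 * p)))) := by
  refine ⟨fun hA X θ hXθ w hw hwQ ↦ ?_, fun hA X θ hXθ w hw hwQ ↦ ?_⟩
  · obtain ⟨⟨A₀, hd, -, ⟨e₀⟩⟩, -⟩ := id hXθ
    have hX : IsSmoothProjective n X := by
      subst hd
      exact (AbelianVariety.isSmoothProjective_holds (A := A₀)).of_iso e₀
    exact hA X θ hXθ w (divisorClassesSpan_le_algebraicClasses_of_isSmoothProjective hX p hw) hwQ
  · obtain ⟨⟨A₀, hd, hD, ⟨e₀⟩⟩, -⟩ := id hXθ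
    have hX : IsSmoothProjective n X := by
      subst hd
      exact (AbelianVariety.isSmoothProjective_holds (A := A₀)).of_iso e₀
    exact hA X θ hXθ w (mem_divisorClassesSpan_of_lefschetzAnchor hd hD e₀ hwQ
      (isOfHodgeType_of_mem_algebraicClasses_of_isSmoothProjective hX p hw)) hwQ

/-- **THE NEW RESIDUAL IS IMPLIED BY THE PREQUEL'S DOUBLY RESIDUAL** (every door, every `(n,p)`, every first residual hypothesis `P`): the cell on
the pencils with «`P` ∧ NO Lefschetz fibre» follows from the cell on the pencils with «`P` ∧ NO elliptic-power fibre» — an elliptic-power fibre IS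
a Lefschetz fibre, so FEWER pencils remain (those through an `S_δ³`-point, a threefold square, … are removed as well).
[cite: MoonenZarhin1999LowDim, Thm. 0.1 (4)] [cite: Bloch1972Semiregularity, Remark (7.5)] -/
theorem under_notLefschetz_of_under_notEllipticPower {P : ∀ ⦃𝒳 S : SchemeOver ℂ⦄, (𝒳 ⟶ S) → complexBetti 𝒳 (2 * p) → Prop}
    (hR : LefAtExceptionalRegimeAtUnder 𝒪 n p (fun _ S f W ↦ P f W ∧
      ¬ ∃ (t : ComplexPoints S) (A₀ E₀ : AbelianVariety ℂ) (N : ℕ),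
        A₀.dim = n ∧ E₀.dim = 1 ∧ A₀.IsIsogenous (E₀.powSucc N) ∧ Nonempty (A₀.X ≅ fiberOver f t))) :
    LefAtExceptionalRegimeAtUnder 𝒪 n p (fun _ S f W ↦ P f W ∧
      ¬ ∃ (t : ComplexPoints S) (A₀ : AbelianVariety ℂ), A₀.dim = n ∧ IsDivisorGenerated A₀ ∧ Nonempty (A₀.X ≅ fiberOver f t)) :=
  under_mono (fun _ _ _ _ h ↦ ⟨h.1, fun ⟨t, A₀, E₀, N, hd, hE₀, hiso, he⟩ ↦
    h.2 ⟨t, lefschetzAnchor_of_ellipticPowerAnchor ⟨A₀, E₀, N, hd, hE₀, hiso, he⟩⟩⟩) hR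

/-- **(b″) ⟸ LEFSCHETZ-FIBRE CARRIERS ∧ THE RESIDUAL ON PENCILS WITH NO PINNED-SERVED AND NO LEFSCHETZ FIBRE** — the second honest special fibre
typed: if at every polarised sixfold `(X, θ)` with `X ≅ A₀`, `B•(A₀) = D•(A₀)` (all the `S_δ³`, `E₀⁶`, `T²`-points and their isogeny classes)
every rational algebraic (= every rational Lefschetz) class `w` has an `AdmTw`-admissible `B`-twisted datum with `κ₃ = a·w + c₃·θ³`, `a ≠ 0`,
sides on the `θ`-ray, AND the twisted-door cell `(6,3)` holds on the pencils with no pinned-served fibre and no Lefschetz fibre, then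
`SecantQuotientResidual63Pinned C`. On a non-split `(3,d,δ)` component the pencils through the QM-cube curve `S_δ³` are in the FIRST conjunct's
charge, with `w` the (Lefschetz) limit of the Weil class and `θ` the component's polarisation. [cite: vanGeemen1994HodgeAV, Thm. 4.11, 5.2 and 5.4]
[cite: Markman2025SecantWeil, Thm. 1.5.1 and §1.5] [cite: MoonenZarhin1999LowDim, §2 (2.2)] [cite: Bloch1972Semiregularity, Remark (7.5)] -/
theorem secantQuotientResidual63Pinned_of_lefschetzCarrierAt_of_under_not_not {C : ChernCharacterBetti}
    (hL : AnchoredCarrierAt (Literature.AlgebraicGeometry.HodgeTheory.twistedReflexiveClass C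
        (fun n X₀ I E => Summit.Ventures.HSemireg.gluableSigmaAdmissible n X₀ I E ∨
          Literature.AlgebraicGeometry.HodgeTheory.bfSingleAdmissible n X₀ I E)) 6 3
      (fun X θ ↦ (∃ A₀ : AbelianVariety ℂ, A₀.dim = 6 ∧ IsDivisorGenerated A₀ ∧ Nonempty (A₀.X ≅ X)) ∧ IsPolarizationClass 6 X θ)
      (fun X _ ↦ (algebraicClasses X 3 : Set (complexBetti X (2 * 3)))))
    (hR : LefAtExceptionalRegimeAtUnder (Literature.AlgebraicGeometry.HodgeTheory.twistedReflexiveClass C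
        (fun n X₀ I E => Summit.Ventures.HSemireg.gluableSigmaAdmissible n X₀ I E ∨
          Literature.AlgebraicGeometry.HodgeTheory.bfSingleAdmissible n X₀ I E)) 6 3
      (fun _ S f W ↦ ¬ HasServedFibre 6 3 (fun X θ ↦ secantQuotientAnchorsPinned X θ)
          (fun X θ ↦ secantQuotientServedClassesPinned X θ) f W ∧
        ¬ ∃ (t : ComplexPoints S) (A₀ : AbelianVariety ℂ), A₀.dim = 6 ∧ IsDivisorGenerated A₀ ∧ Nonempty (A₀.X ≅ fiberOver f t))) :
    SecantQuotientResidual63Pinned C := by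
  intro 𝒳 S f hf h𝒳 hirr haff hsm hdim hab hsec W hW s₀ halg hexc hns
  by_cases hlef : ∃ (t : ComplexPoints S) (A₀ : AbelianVariety ℂ), A₀.dim = 6 ∧ IsDivisorGenerated A₀ ∧ Nonempty (A₀.X ≅ fiberOver f t)
  · exact under_lefschetzFibre_of_lefschetzCarrierAt hL f hf h𝒳 hirr haff hsm hdim hab hsec W hW s₀ halg hexc hlef
  · exact hR f hf h𝒳 hirr haff hsm hdim hab hsec W hW s₀ halg hexc ⟨hns, hlef⟩

/-- **THE REGISTERED `(6,3)` RUNG from (2a″), the Lefschetz-fibre carriers and the residual** (no pencil-level content beyond the two per-variety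
carrier statements and the cell on pencils avoiding pinned-served and Lefschetz fibres). [cite: Markman2025SecantWeil, Thm. 1.4.1 and Thm. 1.5.1]
[cite: vanGeemen1994HodgeAV, Thm. 4.11] [cite: Bloch1972Semiregularity, Remark (7.5)] -/
theorem rung_sixfoldMiddleTw_of_anchorCarrier63Pinned_of_lefschetzCarrierAt_of_under_not_not {C : ChernCharacterBetti}
    (hA : SecantQuotientAnchorCarrier63Pinned C)
    (hL : AnchoredCarrierAt (Literature.AlgebraicGeometry.HodgeTheory.twistedReflexiveClass C
        (fun n X₀ I E => Summit.Ventures.HSemireg.gluableSigmaAdmissible n X₀ I E ∨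
          Literature.AlgebraicGeometry.HodgeTheory.bfSingleAdmissible n X₀ I E)) 6 3
      (fun X θ ↦ (∃ A₀ : AbelianVariety ℂ, A₀.dim = 6 ∧ IsDivisorGenerated A₀ ∧ Nonempty (A₀.X ≅ X)) ∧ IsPolarizationClass 6 X θ)
      (fun X _ ↦ (algebraicClasses X 3 : Set (complexBetti X (2 * 3)))))
    (hR : LefAtExceptionalRegimeAtUnder (Literature.AlgebraicGeometry.HodgeTheory.twistedReflexiveClass C
        (fun n X₀ I E => Summit.Ventures.HSemireg.gluableSigmaAdmissible n X₀ I E ∨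
          Literature.AlgebraicGeometry.HodgeTheory.bfSingleAdmissible n X₀ I E)) 6 3
      (fun _ S f W ↦ ¬ HasServedFibre 6 3 (fun X θ ↦ secantQuotientAnchorsPinned X θ)
          (fun X θ ↦ secantQuotientServedClassesPinned X θ) f W ∧
        ¬ ∃ (t : ComplexPoints S) (A₀ : AbelianVariety ℂ), A₀.dim = 6 ∧ IsDivisorGenerated A₀ ∧ Nonempty (A₀.X ≅ fiberOver f t))) :
    LefAtExceptionalRegimeSixfoldMiddle (Literature.AlgebraicGeometry.HodgeTheory.twistedReflexiveClass C
      (fun n X₀ I E => Summit.Ventures.HSemireg.gluableSigmaAdmissible n X₀ I E ∨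
        Literature.AlgebraicGeometry.HodgeTheory.bfSingleAdmissible n X₀ I E)) :=
  lefAtExceptionalRegimeSixfoldMiddle_of_anchoredCarrierAt_of_under_not hA
    (secantQuotientResidual63Pinned_of_lefschetzCarrierAt_of_under_not_not hL hR)

/-- **(b″) from Lefschetz-fibre carriers and THE PREQUEL'S doubly residual** (pencils with no pinned-served and no elliptic-power fibre) — so
the new conjunct pair is formally no stronger an ask than the prequel's. [cite: MoonenZarhin1999LowDim, Thm. 0.1 (4)]
[cite: Markman2025SecantWeil, Thm. 1.5.1] [cite: Bloch1972Semiregularity, Remark (7.5)] -/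
theorem secantQuotientResidual63Pinned_of_lefschetzCarrierAt_of_under_not_notEllipticPower {C : ChernCharacterBetti}
    (hL : AnchoredCarrierAt (Literature.AlgebraicGeometry.HodgeTheory.twistedReflexiveClass C
        (fun n X₀ I E => Summit.Ventures.HSemireg.gluableSigmaAdmissible n X₀ I E ∨
          Literature.AlgebraicGeometry.HodgeTheory.bfSingleAdmissible n X₀ I E)) 6 3
      (fun X θ ↦ (∃ A₀ : AbelianVariety ℂ, A₀.dim = 6 ∧ IsDivisorGenerated A₀ ∧ Nonempty (A₀.X ≅ X)) ∧ IsPolarizationClass 6 X θ)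
      (fun X _ ↦ (algebraicClasses X 3 : Set (complexBetti X (2 * 3)))))
    (hR : LefAtExceptionalRegimeAtUnder (Literature.AlgebraicGeometry.HodgeTheory.twistedReflexiveClass C
        (fun n X₀ I E => Summit.Ventures.HSemireg.gluableSigmaAdmissible n X₀ I E ∨
          Literature.AlgebraicGeometry.HodgeTheory.bfSingleAdmissible n X₀ I E)) 6 3
      (fun _ S f W ↦ ¬ HasServedFibre 6 3 (fun X θ ↦ secantQuotientAnchorsPinned X θ)
          (fun X θ ↦ secantQuotientServedClassesPinned X θ) f W ∧
        ¬ ∃ (t : ComplexPoints S) (A₀ E₀ : AbelianVariety ℂ) (N : ℕ),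
          A₀.dim = 6 ∧ E₀.dim = 1 ∧ A₀.IsIsogenous (E₀.powSucc N) ∧ Nonempty (A₀.X ≅ fiberOver f t))) :
    SecantQuotientResidual63Pinned C :=
  secantQuotientResidual63Pinned_of_lefschetzCarrierAt_of_under_not_not hL (under_notLefschetz_of_under_notEllipticPower hR)

/-! ## §4 The door-level form of the Lefschetz-fibre carrier statement at `I = {p}` -/

/-- **A `{p−1}`-SEMIREGULAR VECTOR BUNDLE WITH A RATIONAL ALGEBRAIC `B`-FIELD AND `(e^{B₀} ch F)_p = a·w + c·θᵖ` FOR EVERY RATIONAL LEFSCHETZ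
CLASS `w` ON EVERY POLARISED DIVISOR-GENERATED ABELIAN `n`-FOLD GIVES THE LEFSCHETZ-FIBRE CARRIER STATEMENT for the twisted door, `I = {p}`**
(any notion `Adm ⊇ bfSingleAdmissible`; the prequel's `anchoredCarrierAt_twisted_of_forall_exists_isISemiregular` composed with §3's served-class
swap). NO side degree typed (honest reading as in the prequel: they return through Pridham Cor. 2.25).
[cite: BuchweitzFlenner2003, Def. 4.1 and §5 (I-semiregular)] [cite: Pridham2024Semiregularity, Cor. 2.25 and Rem. 2.26] [cite: vanGeemen1994HodgeAV, §2.4] -/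
theorem lefschetzCarrierAt_twisted_of_forall_exists_isISemiregular {C : ChernCharacterBetti} {Adm : PerfectAdmissibility}
    (hAdm : ∀ n X₀ I E, bfSingleAdmissible n X₀ I E → Adm n X₀ I E)
    (h : ∀ (X : SchemeOver ℂ) (θ : complexBetti X 2),
      ((∃ A₀ : AbelianVariety ℂ, A₀.dim = n ∧ IsDivisorGenerated A₀ ∧ Nonempty (A₀.X ≅ X)) ∧ IsPolarizationClass n X θ) →
      ∀ w : complexBetti X (2 * p), w ∈ divisorClassesSpan X n p → IsRationalClass w →
      ∃ (F : X.left.Modules) (hF : IsFiniteLocallyFree F) (B₀ : complexBetti X 2) (a c : ℂ),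
        IsISemiregular hF {q | q + 1 ∈ ({p} : Finset ℕ)} ∧ IsRationalClass B₀ ∧ B₀ ∈ algebraicClasses X 1 ∧ a ≠ 0 ∧
        expTwistCh C X B₀ F p = a • w + c • cupPowTwo θ p) :
    AnchoredCarrierAt (twistedReflexiveClass C Adm) n p
      (fun X θ ↦ (∃ A₀ : AbelianVariety ℂ, A₀.dim = n ∧ IsDivisorGenerated A₀ ∧ Nonempty (A₀.X ≅ X)) ∧ IsPolarizationClass n X θ)
      (fun X _ ↦ (algebraicClasses X p : Set (complexBetti X (2 * p)))) :=
  anchoredCarrierAt_lefschetz_iff_divisorial.2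
    (anchoredCarrierAt_twisted_of_forall_exists_isISemiregular hAdm fun X θ hXθ w hw hwQ ↦ h X θ hXθ w hw hwQ)

/-- **Instance: the LEFSCHETZ-FIBRE carrier statement at `(6,3)` for the crux's door from `{2}`-semiregular vector bundles** — for every
`X ≅ A₀` with `B•(A₀) = D•(A₀)` (e.g. `A₀ ~ S_δ³`), polarisation class `θ`, rational `w ∈ D³(X) ⊗ ℂ`: a finite locally free `F`, a rational
algebraic `B₀`, `a ≠ 0`, `c` with `σ₂` injective on `Ext²(F,F)` and `(e^{B₀} ch F)₃ = a·w + c·θ³`.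
[cite: BuchweitzFlenner2003, §5 (I-semiregular) and Thm. 5.1] [cite: Pridham2024Semiregularity, Cor. 2.25 and Rem. 2.26] [cite: MumfordAV1970, §16] -/
theorem lefschetzCarrierAt63_twAdm_of_forall_exists_isISemiregular {C : ChernCharacterBetti}
    (h : ∀ (X : SchemeOver ℂ) (θ : complexBetti X 2),
      ((∃ A₀ : AbelianVariety ℂ, A₀.dim = 6 ∧ IsDivisorGenerated A₀ ∧ Nonempty (A₀.X ≅ X)) ∧ IsPolarizationClass 6 X θ) →
      ∀ w : complexBetti X (2 * 3), w ∈ divisorClassesSpan X 6 3 → IsRationalClass w →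
      ∃ (F : X.left.Modules) (hF : IsFiniteLocallyFree F) (B₀ : complexBetti X 2) (a c : ℂ),
        IsISemiregular hF {q | q + 1 ∈ ({3} : Finset ℕ)} ∧ IsRationalClass B₀ ∧ B₀ ∈ algebraicClasses X 1 ∧ a ≠ 0 ∧
        expTwistCh C X B₀ F 3 = a • w + c • cupPowTwo θ 3) :
    AnchoredCarrierAt (Literature.AlgebraicGeometry.HodgeTheory.twistedReflexiveClass C
        (fun n X₀ I E => Summit.Ventures.HSemireg.gluableSigmaAdmissible n X₀ I E ∨
          Literature.AlgebraicGeometry.HodgeTheory.bfSingleAdmissible n X₀ I E)) 6 3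
      (fun X θ ↦ (∃ A₀ : AbelianVariety ℂ, A₀.dim = 6 ∧ IsDivisorGenerated A₀ ∧ Nonempty (A₀.X ≅ X)) ∧ IsPolarizationClass 6 X θ)
      (fun X _ ↦ (algebraicClasses X 3 : Set (complexBetti X (2 * 3)))) :=
  lefschetzCarrierAt_twisted_of_forall_exists_isISemiregular (fun _ _ _ _ h ↦ Or.inr h) h

end Summit.HodgeConjecture.HodgeConjecture.Ring2.SemiregularRepresentatives

end
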